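import Mathlib
import Summits.Ventures.HodgeRepro.Tier4.Line1.HeckeFinitenessType

/-!
# Tier4/Line1/LevelBlockFinite — (A) AS A THEOREM: the level block of a type is finite-dimensional

Blind re-derivation cell `pub-hodge-repro`, Tier 4 (README §9–§10), seat t4-L1-p1 (gen 3).  Target tree path
`lean/Summits/Ventures/HodgeRepro/Tier4/Line1/LevelBlockFinite.lean`.  Imports this seat's `HeckeFinitenessType`
(p682171: `HasLeftType`, `evalCosets`, `eq_zero_of_evalCosets_eq_zero`) and through it `HeckeFiniteness`
(`exists_finset_doubleCoset_cover`).

WHAT THIS IS.  Fact (A) of the (S3a) chain (proofs/t4/L1/I4-anatomy-t4-L1-p1.md §2; t4-L1-p5's `HeckeIsolation` displays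
it as «a finite block `Vb`»): for an OPEN subgroup `K ≤ G` and a finite-rank left type `e : Fin r → K → ℂ`, the
ℂ-subspace `levelBlock S K e` of ALL `Gk`-invariant functions whose right-`K`-coset functions `k ↦ ψ (x k)` lie in
`span (range e)` is FINITE-DIMENSIONAL (`finiteDimensional_levelBlock`), of dimension at most
`|Gk\G/K| · finrank (span (range e))` (`finrank_levelBlock_le`).  Proof: the coset evaluation `ψ ↦ (g, k) ↦ ψ (g k)` on
the finitely many representatives `s` of `Gk\G/K` (`exists_finset_doubleCoset_cover`) is a ℂ-linear map, injective on
`Gk`-invariant functions (every `x = γ g k`, `eq_zero_of_evalCosets_eq_zero`) and lands in `s → span (range e)`, which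
is finite-dimensional.  No continuity, no measure, no orthonormal basis enters; `[Countable S.Gk]` is not needed.
Corollary `finiteDimensional_inf_levelBlock`: the intersection of ANY ℂ-subspace (a constituent `τ m`, the whole
`K`-block) with the level block is finite-dimensional.  On L1's instance `K = K_f × U(W)(ℝ)` (open; the plane is
totally definite) and `e` = the matrix coefficients of the archimedean type `σ`: the `K_f`-fixed `σ`-isotypic
automorphic forms form a finite-dimensional space — the «finite spectrum at a level and a type».  0 print.
NOT claimed: simplicity or non-isomorphism of the blocks ((C1), (C2)), the density of admissible vectors, or anything
about (P).  Nothing here says anything about the status of the Hodge conjecture for CM abelian varieties, which is NOT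
proved (HC_CM is NOT proved by anyone in this repository).
-/

set_option autoImplicit false

noncomputable section

namespace Summit.Ventures.HodgeRepro.Tier4.Line1

open MeasureTheory Topology

namespace RTF

namespace Setting

variable {G : Type} [Group G] [TopologicalSpace G] [IsTopologicalGroup G] [MeasurableSpace G] [BorelSpace G]
  (S : Setting G) (K : Subgroup G) {r : ℕ} (e : Fin r → K → ℂ)

/-- **the level block of the type `e`**: all `Gk`-invariant functions whose right-`K`-coset functions lie in
`span (range e)`, as a ℂ-subspace of `G → ℂ`. -/
def levelBlock : Submodule ℂ (G → ℂ) where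
  carrier := {ψ | S.Invariant ψ ∧ HasLeftType K e ψ}
  add_mem' := by
    intro a b ha hb
    refine ⟨fun γ x => ?_, fun x => ?_⟩
    · simp only [Pi.add_apply]
      rw [ha.1 γ x, hb.1 γ x]
    · have : (fun k : K => (a + b) (x * k)) = (fun k : K => a (x * k)) + fun k : K => b (x * k) := by
        funext k
        rfl
      rw [this]
      exact Submodule.add_mem _ (ha.2 x) (hb.2 x)
  zero_mem' := by
    refine ⟨fun γ x => rfl, fun x => ?_⟩
    have : (fun k : K => (0 : G → ℂ) (x * k)) = 0 := by
      funext k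
      rfl
    rw [this]
    exact Submodule.zero_mem _
  smul_mem' := by
    intro c a ha
    refine ⟨fun γ x => ?_, fun x => ?_⟩
    · simp only [Pi.smul_apply]
      rw [ha.1 γ x]
    · have : (fun k : K => (c • a) (x * k)) = c • fun k : K => a (x * k) := by
        funext k
        rfl
      rw [this]
      exact Submodule.smul_mem _ _ (ha.2 x)

omit [IsTopologicalGroup G] [BorelSpace G] in
/-- membership in the level block. -/
theorem mem_levelBlock {ψ : G → ℂ} : ψ ∈ levelBlock S K e ↔ S.Invariant ψ ∧ HasLeftType K e ψ := Iff.rfl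

/-- **the coset evaluation as a ℂ-linear map** from the level block into `s → span (range e)`. -/
def evalCosetsLinear (s : Finset G) : levelBlock S K e →ₗ[ℂ] (s → Submodule.span ℂ (Set.range e)) where
  toFun := fun ψ g => ⟨evalCosets K s ψ g, ψ.2.2 g⟩
  map_add' := by
    intro a b
    funext g
    apply Subtype.ext
    funext k
    rfl
  map_smul' := by
    intro c a
    funext g
    apply Subtype.ext
    funext k
    rfl

omit [IsTopologicalGroup G] [BorelSpace G] in
/-- the coset evaluation is injective on the level block (every `x = γ g k`; `Gk`-invariance). -/
theorem evalCosetsLinear_injective {s : Finset G}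
    (hs : ∀ x : G, ∃ g ∈ s, ∃ γ : S.Gk, ∃ k ∈ K, x = (γ : G) * g * k) :
    Function.Injective (evalCosetsLinear S K e s) := by
  rw [← LinearMap.ker_eq_bot, LinearMap.ker_eq_bot']
  intro ψ hψ
  apply Subtype.ext
  refine S.eq_zero_of_evalCosets_eq_zero K hs ψ.2.1 ?_
  funext g k
  have h2 := congrArg Subtype.val (congrFun hψ g)
  exact congrFun h2 k

omit [BorelSpace G] in
/-- **(A) — THE LEVEL BLOCK IS FINITE-DIMENSIONAL** for an open subgroup `K` and a finite-rank type `e`. -/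
theorem finiteDimensional_levelBlock (hK : IsOpen (K : Set G)) : FiniteDimensional ℂ (levelBlock S K e) := by
  obtain ⟨s, hs⟩ := S.exists_finset_doubleCoset_cover K hK
  haveI : FiniteDimensional ℂ (Submodule.span ℂ (Set.range e)) :=
    FiniteDimensional.span_of_finite ℂ (Set.finite_range e)
  exact FiniteDimensional.of_injective (evalCosetsLinear S K e s) (S.evalCosetsLinear_injective K e hs)

omit [IsTopologicalGroup G] [BorelSpace G] in
/-- the dimension bound: `finrank (levelBlock) ≤ |s| · finrank (span (range e))` for any set of representatives `s`. -/
theorem finrank_levelBlock_le {s : Finset G}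
    (hs : ∀ x : G, ∃ g ∈ s, ∃ γ : S.Gk, ∃ k ∈ K, x = (γ : G) * g * k) :
    Module.finrank ℂ (levelBlock S K e) ≤ s.card * Module.finrank ℂ (Submodule.span ℂ (Set.range e)) := by
  haveI : FiniteDimensional ℂ (Submodule.span ℂ (Set.range e)) :=
    FiniteDimensional.span_of_finite ℂ (Set.finite_range e)
  have h := LinearMap.finrank_le_finrank_of_injective (S.evalCosetsLinear_injective K e hs)
  rw [Module.finrank_pi_fintype, Finset.sum_const, Finset.card_univ, Fintype.card_coe, smul_eq_mul] at h
  exact h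

omit [BorelSpace G] in
/-- every ℂ-subspace meets the level block in a finite-dimensional subspace (a constituent `τ m`, the `K`-block). -/
theorem finiteDimensional_inf_levelBlock (hK : IsOpen (K : Set G)) (V : Submodule ℂ (G → ℂ)) :
    FiniteDimensional ℂ (V ⊓ levelBlock S K e : Submodule ℂ (G → ℂ)) := by
  haveI := S.finiteDimensional_levelBlock K e hK
  exact Submodule.finiteDimensional_of_le inf_le_right

end Setting

end RTF

end Summit.Ventures.HodgeRepro.Tier4.Line1

end
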